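import Summits.RiemannHypothesis.RiemannHypothesis.Theorems.JensenLogBandArcModel
import Summits.RiemannHypothesis.RiemannHypothesis.Theorems.JensenLogBandArcRadius
import Summits.RiemannHypothesis.RiemannHypothesis.Theorems.JensenLogBandGammaFactorStirling
import HarnessLib

/-!
# Existence of the model saddle of the right half-arc transform (BAND line, step S3) — part 1: the denominator

RH ladder column JENSEN, rung J-P(P3) «log band», BAND crux `XiDerivBandRealAllRates` of route
«JensenLogBand», line «band-one-window» (u-arc reshape), lead rh-jensen-prover g7 — step (S3) of
HOME/rh-jensen-prover/g7-work/LINE-PLAN.md §6. RH-FREE (Γ-factor only; no `ζ`). WHAT THIS IS NOT: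
nothing here bears on zeros of `ζ` or the truth of RH.

**The statement.** Let `c = x + iT` with `|x| ≤ ½`, `ℓ = ℓ_T = log(T/2π) ≥ 20`, `T ≥ 100`, and let
`h = h(n,T) = 2(n+1)/ℓ` be the band radius (`LogBandArc.bandRadius`) with `½ ≤ h ≤ (7/20)·T`
(the band's lower edge gives `h/T ≲ 0.33`, LINE-PLAN §5). Then the saddle function
`S_{n,c}(u) = λ′(½+u) + 1/u − n/(u−c) − (n+1)/(u+c)` (`LogBandArc.arcSaddleFn`, with
`λ′ = (log γ̃)′`) has a zero `u*` with `‖u* − (c + h)‖ ≤ (3/5)·h`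
(`LogBandArc.exists_arcSaddleFn_eq_zero`).

(The fixed point itself is produced in `JensenLogBandArcSaddle.lean`; this file defines `λ′`, `D`
and proves the disc geometry and the bounds `Re D ∈ [(9/20)ℓ, (14/25)ℓ]`,
`Im D ∈ [−1/10, 9/10 + ℓ/10]`.)

**The proof** is Banach's fixed-point theorem for `u ↦ c + n / D(u)`,
`D(u) = λ′(½+u) + 1/u − (n+1)/(u+c)`, on the closed disc `|u − (c+h)| ≤ (3/5)h`: there
`Re D ≥ (9/20)ℓ`, `−1/10 ≤ Im D ≤ 9/10 + ℓ/10` (first-order Stirling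
`λ′ = ½Log(s/2π) + O(6/Im s)`, eng-2 g5's `norm_xiGammaLogDeriv_sub_half_log_le_of_re_nonneg`,
plus `0 ≤ arg s ≤ π/2`), so `‖n/D(u) − h‖ ≤ h/3 + 2h/ℓ ≤ (3/5)h` (maps into), and
`‖(n/D)′‖ = n‖D′‖/‖D‖² ≤ 21·(h/T)/ℓ + (2/5)(h/T)² ≤ ½` (contraction; `‖λ″‖ ≤ 8.3/T` from
`norm_xiGammaLogDeriv2_sub_le_of_re_nonneg`).
-/

noncomputable section

-- single-problem summit: `Summit.RiemannHypothesis.RiemannHypothesis.…` is the tree convention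
set_option linter.dupNamespace false

open Complex Real Set Metric

namespace Summit.RiemannHypothesis.RiemannHypothesis.Theorems.JensenPolynomials.LogBandArc

open Literature.NumberTheory.LFunctions

/-! ## The explicit `λ′` and the fixed-point map -/

/-- eng-2 g5's explicit `λ′(s) = 1/s + 1/(s−1) − ½ log π + ½ ψ(s/2)` (`= logDeriv xiGammaFactor s`
for `Re s > 0`, `s ≠ 1`). [folklore] -/
def lamPrime (s : ℂ) : ℂ :=
  1 / s + 1 / (s - 1) - Complex.log (Real.pi : ℂ) / 2 + Complex.digamma (s / 2) / 2

/-- The denominator `D(u) = λ′(½+u) + 1/u − (n+1)/(u+c)` of the fixed-point map. [folklore] -/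
def saddleDen (n : ℕ) (c u : ℂ) : ℂ := lamPrime (1 / 2 + u) + 1 / u - ((n : ℂ) + 1) / (u + c)

/-- `S_{n,c}(u) = D(u) − n/(u − c)` when `Re(½+u) > 0`, `½ + u ≠ 1`. [folklore] -/
theorem arcSaddleFn_eq_saddleDen_sub (n : ℕ) (c : ℂ) {u : ℂ} (hre : 0 < (1 / 2 + u).re)
    (h1 : 1 / 2 + u ≠ 1) :
    arcSaddleFn n c u = saddleDen n c u - n / (u - c) := by
  rw [arcSaddleFn, logDeriv_xiGammaFactor_of_re_pos hre h1, saddleDen, lamPrime]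
  ring

/-! ## Geometry of the disc `|u − (c + h)| ≤ (3/5) h` -/

section geometry

variable {x T h : ℝ} {u : ℂ}

/-- Coordinates on the disc: `|Im u − T| ≤ (3/5)h` and `|Re u − (x + h)| ≤ (3/5)h`. [folklore] -/
theorem disc_coords (hu : ‖u - ((x : ℂ) + (T : ℂ) * I + h)‖ ≤ 3 / 5 * h) :
    |u.im - T| ≤ 3 / 5 * h ∧ |u.re - (x + h)| ≤ 3 / 5 * h := by
  have him : |(u - ((x : ℂ) + (T : ℂ) * I + h)).im| ≤ 3 / 5 * h :=
    (Complex.abs_im_le_norm _).trans hu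
  have hre : |(u - ((x : ℂ) + (T : ℂ) * I + h)).re| ≤ 3 / 5 * h :=
    (Complex.abs_re_le_norm _).trans hu
  simp at him hre
  exact ⟨by simpa using him, hre⟩

/-- **Geometry of the disc.** For `|x| ≤ ½`, `T ≥ 100`, `½ ≤ h ≤ (7/20)T` and
`‖u − (c + h)‖ ≤ (3/5)h` (`c = x + iT`), with `s = ½ + u`:
`(79/100)T ≤ Im s ≤ T + (3/5)h`, `1/5 ≤ Re s ≤ 1 + (8/5)h`, `(79/100)T ≤ ‖s‖ ≤ (89/50)T`,
`‖u‖ ≥ (79/100)T`, `Im(u+c) ≥ (179/100)T`, `|Re(u+c)| ≤ 1 + (8/5)h`, `‖u+c‖ ≥ (179/100)T`.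
[folklore] -/
theorem disc_geometry (hx : |x| ≤ 1 / 2) (hT : 100 ≤ T) (hh : 1 / 2 ≤ h) (hhT : h ≤ 7 / 20 * T)
    (hu : ‖u - ((x : ℂ) + (T : ℂ) * I + h)‖ ≤ 3 / 5 * h) :
    79 / 100 * T ≤ (1 / 2 + u).im ∧ (1 / 2 + u).im ≤ T + 3 / 5 * h ∧
    1 / 5 ≤ (1 / 2 + u).re ∧ (1 / 2 + u).re ≤ 1 + 8 / 5 * h ∧
    79 / 100 * T ≤ ‖1 / 2 + u‖ ∧ ‖1 / 2 + u‖ ≤ 89 / 50 * T ∧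
    79 / 100 * T ≤ ‖u‖ ∧ 179 / 100 * T ≤ (u + ((x : ℂ) + (T : ℂ) * I)).im ∧
    |(u + ((x : ℂ) + (T : ℂ) * I)).re| ≤ 1 + 8 / 5 * h ∧
    179 / 100 * T ≤ ‖u + ((x : ℂ) + (T : ℂ) * I)‖ := by
  obtain ⟨him, hre⟩ := disc_coords hu
  have hx' := abs_le.1 hx
  have him' := abs_le.1 him
  have hre' := abs_le.1 hre
  have hsim : (1 / 2 + u).im = u.im := by simp
  have hsre : (1 / 2 + u).re = 1 / 2 + u.re := by simp
  have h1 : 79 / 100 * T ≤ (1 / 2 + u).im := by rw [hsim]; linarith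
  have h2 : (1 / 2 + u).im ≤ T + 3 / 5 * h := by rw [hsim]; linarith
  have h3 : 1 / 5 ≤ (1 / 2 + u).re := by rw [hsre]; linarith
  have h4 : (1 / 2 + u).re ≤ 1 + 8 / 5 * h := by rw [hsre]; linarith
  have h5 : 79 / 100 * T ≤ ‖1 / 2 + u‖ :=
    h1.trans ((le_abs_self _).trans (Complex.abs_im_le_norm _))
  have h6 : ‖1 / 2 + u‖ ≤ 89 / 50 * T := by
    have := Complex.norm_le_abs_re_add_abs_im (1 / 2 + u)
    rw [abs_of_nonneg (by linarith : 0 ≤ (1 / 2 + u).re),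
      abs_of_nonneg (by linarith : 0 ≤ (1 / 2 + u).im)] at this
    linarith
  have h7 : 79 / 100 * T ≤ ‖u‖ := by
    have : 79 / 100 * T ≤ u.im := by linarith
    exact this.trans ((le_abs_self _).trans (Complex.abs_im_le_norm _))
  have hucim : (u + ((x : ℂ) + (T : ℂ) * I)).im = u.im + T := by simp
  have hucre : (u + ((x : ℂ) + (T : ℂ) * I)).re = u.re + x := by simp
  have h8 : 179 / 100 * T ≤ (u + ((x : ℂ) + (T : ℂ) * I)).im := by rw [hucim]; linarith
  have h9 : |(u + ((x : ℂ) + (T : ℂ) * I)).re| ≤ 1 + 8 / 5 * h := by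
    rw [hucre, abs_le]; constructor <;> linarith
  have h10 : 179 / 100 * T ≤ ‖u + ((x : ℂ) + (T : ℂ) * I)‖ :=
    h8.trans ((le_abs_self _).trans (Complex.abs_im_le_norm _))
  exact ⟨h1, h2, h3, h4, h5, h6, h7, h8, h9, h10⟩

end geometry

/-! ## Bounds for the denominator `D(u)` on the disc -/

section den

variable {n : ℕ} {x T : ℝ} {u : ℂ}

/-- `Log(s/(2π))/2` has real part `(log ‖s‖ − log(2π))/2` and imaginary part `(arg s)/2 ∈ [0, π/4]`
when `Re s ≥ 0`, `Im s ≥ 0`, `s ≠ 0`. [folklore] -/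
theorem half_log_div_two_pi_re_im {s : ℂ} (hs : s ≠ 0) (hre : 0 ≤ s.re) (him : 0 ≤ s.im) :
    (Complex.log (s / (2 * Real.pi)) / 2).re = (Real.log ‖s‖ - Real.log (2 * Real.pi)) / 2 ∧
    0 ≤ (Complex.log (s / (2 * Real.pi)) / 2).im ∧
    (Complex.log (s / (2 * Real.pi)) / 2).im ≤ Real.pi / 4 := by
  have h2π : (0 : ℝ) < 2 * Real.pi := by positivity
  have hcast : s / (2 * (Real.pi : ℂ)) = s * (((2 * Real.pi)⁻¹ : ℝ) : ℂ) := by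
    push_cast
    field_simp
  have hre2 : (Complex.log (s / (2 * Real.pi)) / 2).re = (Complex.log (s / (2 * Real.pi))).re / 2 := by
    simp
  have him2 : (Complex.log (s / (2 * Real.pi)) / 2).im = (Complex.log (s / (2 * Real.pi))).im / 2 := by
    simp
  rw [hre2, him2, Complex.log_re, Complex.log_im]
  have hnorm : ‖s / (2 * (Real.pi : ℂ))‖ = ‖s‖ / (2 * Real.pi) := by
    rw [norm_div]
    congr 1
    rw [show (2 * (Real.pi : ℂ)) = ((2 * Real.pi : ℝ) : ℂ) by push_cast; ring, Complex.norm_real,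
      Real.norm_eq_abs, abs_of_pos h2π]
  have harg : Complex.arg (s / (2 * (Real.pi : ℂ))) = Complex.arg s := by
    rw [hcast, Complex.arg_mul_real (inv_pos.2 h2π)]
  refine ⟨?_, ?_, ?_⟩
  · rw [hnorm, Real.log_div (norm_ne_zero_iff.2 hs) h2π.ne']
  · rw [harg]
    have := Complex.arg_nonneg_iff.2 him
    linarith
  · rw [harg]
    have := Complex.arg_le_pi_div_two_iff.2 (Or.inl hre)
    linarith

/-- Standing numeric hypotheses of the saddle construction: `|x| ≤ ½`, `T ≥ 100`, `ℓ_T ≥ 20`,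
`n ≥ 100`, `½ ≤ h(n,T) ≤ (7/20) T`. Consequence used throughout: `h ℓ_T = 2(n+1)`. [folklore] -/
theorem bandRadius_mul_ell {n : ℕ} {T : ℝ} (hℓ : 20 ≤ ell T) :
    bandRadius n T * ell T = 2 * ((n : ℝ) + 1) := by
  have : ell T ≠ 0 := by linarith
  rw [bandRadius]; field_simp

/-- **Real- and imaginary-part bounds for `D(u)` on the disc:**
`(9/20)ℓ ≤ Re D ≤ (14/25)ℓ` and `−1/10 ≤ Im D ≤ 9/10 + ℓ/10`. [folklore] -/
theorem saddleDen_re_im_bounds (hx : |x| ≤ 1 / 2) (hT : 100 ≤ T) (hℓ : 20 ≤ ell T)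
    (hh : 1 / 2 ≤ bandRadius n T) (hhT : bandRadius n T ≤ 7 / 20 * T)
    (hu : ‖u - ((x : ℂ) + (T : ℂ) * I + bandRadius n T)‖ ≤ 3 / 5 * bandRadius n T) :
    9 / 20 * ell T ≤ (saddleDen n ((x : ℂ) + (T : ℂ) * I) u).re ∧
    (saddleDen n ((x : ℂ) + (T : ℂ) * I) u).re ≤ 14 / 25 * ell T ∧
    -(1 / 10) ≤ (saddleDen n ((x : ℂ) + (T : ℂ) * I) u).im ∧
    (saddleDen n ((x : ℂ) + (T : ℂ) * I) u).im ≤ 9 / 10 + ell T / 10 := by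
  set h := bandRadius n T with hhdef
  set ℓ := ell T with hℓdef
  set c : ℂ := (x : ℂ) + (T : ℂ) * I with hc
  set s : ℂ := 1 / 2 + u with hs
  obtain ⟨him_lo, him_hi, hre_lo, hre_hi, hns_lo, hns_hi, hnu_lo, hucim, hucre, hnuc⟩ :=
    disc_geometry hx hT hh hhT hu
  rw [← hc] at hucim hucre hnuc
  rw [← hs] at him_lo him_hi hre_lo hre_hi hns_lo hns_hi
  have hT0 : 0 < T := by linarith
  have hhℓ : h * ℓ = 2 * ((n : ℝ) + 1) := bandRadius_mul_ell hℓ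
  have hτ : h / T ≤ 7 / 20 := by rw [div_le_iff₀ hT0]; linarith
  have hs0 : s ≠ 0 := by
    intro h0
    rw [h0, norm_zero] at hns_lo
    linarith
  have him0 : 0 < s.im := him_lo.trans_lt' (by linarith)
  -- Stirling error
  have hE : ‖lamPrime s - Complex.log (s / (2 * Real.pi)) / 2‖ ≤ 6 / s.im := by
    unfold lamPrime
    exact norm_xiGammaLogDeriv_sub_half_log_le_of_re_nonneg (by linarith) (by linarith)
  have hE' : ‖lamPrime s - Complex.log (s / (2 * Real.pi)) / 2‖ ≤ 2 / 25 := by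
    refine hE.trans ?_
    rw [div_le_div_iff₀ him0 (by norm_num)]
    linarith
  set E := lamPrime s - Complex.log (s / (2 * Real.pi)) / 2 with hEdef
  have hEre : |E.re| ≤ 2 / 25 := (Complex.abs_re_le_norm E).trans hE'
  have hEim : |E.im| ≤ 2 / 25 := (Complex.abs_im_le_norm E).trans hE'
  -- the main term
  obtain ⟨hLre, hLim0, hLim1⟩ := half_log_div_two_pi_re_im hs0 (by linarith) him0.le
  have hlogT : Real.log (2 * Real.pi) = Real.log T - ℓ := by
    rw [hℓdef, ell, Real.log_div hT0.ne' (by positivity)]; ring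
  -- `(log ‖s‖ − log T)/2 ∈ [−27/200, 39/100]`
  have hlog_lo : -(27 / 100) ≤ Real.log ‖s‖ - Real.log T := by
    have h1 : Real.log (79 / 100 * T) ≤ Real.log ‖s‖ := Real.log_le_log (by positivity) hns_lo
    rw [Real.log_mul (by norm_num) hT0.ne'] at h1
    have h2 : -(27 / 100) ≤ Real.log (79 / 100 : ℝ) := by
      have := Real.log_le_sub_one_of_pos (show (0:ℝ) < 100 / 79 by norm_num)
      rw [show (100 / 79 : ℝ) = (79 / 100)⁻¹ by norm_num, Real.log_inv] at this
      linarith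
    linarith
  have hlog_hi : Real.log ‖s‖ - Real.log T ≤ 78 / 100 := by
    have h1 : Real.log ‖s‖ ≤ Real.log (89 / 50 * T) :=
      Real.log_le_log (by linarith) hns_hi
    rw [Real.log_mul (by norm_num) hT0.ne'] at h1
    have h2 : Real.log (89 / 50 : ℝ) ≤ 78 / 100 := by
      have := Real.log_le_sub_one_of_pos (show (0:ℝ) < 89 / 50 by norm_num)
      linarith
    linarith
  -- `1/u`
  have hinvu : ‖1 / u‖ ≤ 2 / 157 := by
    rw [norm_div, norm_one]
    exact (div_le_div_iff₀ (by linarith) (by norm_num)).2 (by linarith)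
  have hinvu_re : |(1 / u).re| ≤ 2 / 157 := (Complex.abs_re_le_norm _).trans hinvu
  have hinvu_im : |(1 / u).im| ≤ 2 / 157 := (Complex.abs_im_le_norm _).trans hinvu
  -- `(n+1)/(u+c)`
  have hnsq : (179 / 100 * T) ^ 2 ≤ Complex.normSq (u + c) := by
    rw [Complex.normSq_eq_norm_sq]
    exact pow_le_pow_left₀ (by positivity) hnuc 2
  have hnsq_pos : 0 < Complex.normSq (u + c) := lt_of_lt_of_le (by positivity) hnsq
  have hnre : ((n : ℂ) + 1).re = (n : ℝ) + 1 := by simp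
  have hnim : ((n : ℂ) + 1).im = 0 := by simp
  have hQre : (((n : ℂ) + 1) / (u + c)).re = ((n : ℝ) + 1) * (u + c).re / Complex.normSq (u + c) := by
    rw [Complex.div_re, hnre, hnim, zero_mul, zero_div, add_zero]
  have hQim : (((n : ℂ) + 1) / (u + c)).im = -(((n : ℝ) + 1) * (u + c).im) / Complex.normSq (u + c) := by
    rw [Complex.div_im, hnre, hnim, zero_mul, zero_div, zero_sub, neg_div]
  have hn1 : (0 : ℝ) < (n : ℝ) + 1 := by positivity
  -- |Re Q| ≤ (n+1)(1 + 8h/5)/(1.79 T)²  ≤ 0.0311 ℓ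
  have hQre_bd : |(((n : ℂ) + 1) / (u + c)).re| ≤ 33 / 1000 * ℓ := by
    rw [hQre, abs_div, abs_of_pos hnsq_pos, div_le_iff₀ hnsq_pos, abs_mul, abs_of_pos hn1]
    have hA : ((n : ℝ) + 1) * |(u + c).re| ≤ ((n : ℝ) + 1) * (1 + 8 / 5 * h) :=
      mul_le_mul_of_nonneg_left hucre hn1.le
    refine hA.trans ?_
    -- (n+1)(1 + 8h/5) ≤ 0.033 ℓ (1.79T)² ≤ 0.033 ℓ normSq
    have hℓ0 : 0 < ℓ := by linarith
    have hh2 : h ^ 2 ≤ 49 / 400 * T ^ 2 := by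
      have := pow_le_pow_left₀ (by linarith : (0 : ℝ) ≤ h) hhT 2
      rw [mul_pow] at this
      norm_num at this
      linarith
    have hT2 : 7 / 20 * T ≤ 7 / 2000 * T ^ 2 := by
      have := mul_le_mul_of_nonneg_left hT (by linarith : 0 ≤ 7 / 2000 * T)
      have e2 : (7 : ℝ) / 2000 * T * 100 = 7 / 20 * T := by ring
      have e3 : (7 : ℝ) / 2000 * T * T = 7 / 2000 * T ^ 2 := by ring
      linarith only [this, e2, e3]
    have h1 : h * (1 + 8 / 5 * h) ≤ 2114706 / 10000000 * T ^ 2 := by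
      have e : h * (1 + 8 / 5 * h) = h + 8 / 5 * h ^ 2 := by ring
      have h3 : h ≤ 7 / 2000 * T ^ 2 := hhT.trans hT2
      have hT2nn : 0 ≤ T ^ 2 := sq_nonneg T
      rw [e]
      linarith only [hh2, h3, hT2nn]
    have hkey : ((n : ℝ) + 1) * (1 + 8 / 5 * h) ≤ 33 / 1000 * ℓ * (179 / 100 * T) ^ 2 := by
      have e : ((n : ℝ) + 1) = h * ℓ / 2 := by linarith only [hhℓ]
      have := mul_le_mul_of_nonneg_left h1 (by linarith only [hℓ0] : 0 ≤ ℓ / 2)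
      calc ((n : ℝ) + 1) * (1 + 8 / 5 * h) = ℓ / 2 * (h * (1 + 8 / 5 * h)) := by rw [e]; ring
        _ ≤ ℓ / 2 * (2114706 / 10000000 * T ^ 2) := this
        _ = 33 / 1000 * ℓ * (179 / 100 * T) ^ 2 := by ring
    exact hkey.trans (mul_le_mul_of_nonneg_left hnsq (by linarith only [hℓ]))
  -- 0 ≤ −Im Q ≤ 0.0978 ℓ
  have hQim_nonpos : (((n : ℂ) + 1) / (u + c)).im ≤ 0 := by
    rw [hQim, div_le_iff₀ hnsq_pos, zero_mul, neg_le, neg_zero]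
    exact mul_nonneg hn1.le (by linarith only [hucim, hT0])
  have hQim_bd : -(((n : ℂ) + 1) / (u + c)).im ≤ 978 / 10000 * ℓ := by
    rw [hQim, neg_div, neg_neg, div_le_iff₀ hnsq_pos]
    -- (n+1) Im(u+c) ≤ 0.0978 ℓ normSq; use normSq ≥ Im(u+c)² and (n+1) ≤ 0.0978 ℓ Im(u+c)
    have hIm0 : 0 < (u + c).im := by linarith only [hucim, hT0]
    have hsq : (u + c).im ^ 2 ≤ Complex.normSq (u + c) := by
      rw [Complex.normSq_apply, sq]
      have := mul_self_nonneg (u + c).re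
      linarith only [this]
    have h1 : ((n : ℝ) + 1) ≤ 978 / 10000 * ℓ * (u + c).im := by
      have e : ((n : ℝ) + 1) = ℓ * (h / 2) := by linarith only [hhℓ]
      have hℓ0 : 0 < ℓ := by linarith only [hℓ]
      have h2 : h / 2 ≤ 978 / 10000 * (u + c).im := by linarith only [hhT, hucim, hT0]
      calc ((n : ℝ) + 1) = ℓ * (h / 2) := e
        _ ≤ ℓ * (978 / 10000 * (u + c).im) := mul_le_mul_of_nonneg_left h2 hℓ0.le
        _ = 978 / 10000 * ℓ * (u + c).im := by ring
    calc ((n : ℝ) + 1) * (u + c).im ≤ 978 / 10000 * ℓ * (u + c).im * (u + c).im :=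
          mul_le_mul_of_nonneg_right h1 hIm0.le
      _ = 978 / 10000 * ℓ * (u + c).im ^ 2 := by ring
      _ ≤ 978 / 10000 * ℓ * Complex.normSq (u + c) :=
          mul_le_mul_of_nonneg_left hsq (by linarith only [hℓ])
  -- assemble: Den = (Log/2 + E) + 1/u − Q
  have hDen : saddleDen n c u = (Complex.log (s / (2 * Real.pi)) / 2 + E) + 1 / u -
      ((n : ℂ) + 1) / (u + c) := by
    rw [saddleDen, hEdef]; ring
  have hDre : (saddleDen n c u).re = (Real.log ‖s‖ - Real.log (2 * Real.pi)) / 2 + E.re +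
      (1 / u).re - (((n : ℂ) + 1) / (u + c)).re := by
    rw [hDen]; simp [hLre]
  have hDim : (saddleDen n c u).im = (Complex.log (s / (2 * Real.pi)) / 2).im + E.im +
      (1 / u).im - (((n : ℂ) + 1) / (u + c)).im := by
    rw [hDen]; simp
  have hEre' := abs_le.1 hEre
  have hEim' := abs_le.1 hEim
  have hinvu_re' := abs_le.1 hinvu_re
  have hinvu_im' := abs_le.1 hinvu_im
  have hQre' := abs_le.1 hQre_bd
  refine ⟨?_, ?_, ?_, ?_⟩
  · rw [hDre, hlogT]
    linarith only [hlog_lo, hEre'.1, hinvu_re'.1, hQre'.2, hℓ]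
  · rw [hDre, hlogT]
    linarith only [hlog_hi, hEre'.2, hinvu_re'.2, hQre'.1, hℓ]
  · rw [hDim]
    linarith only [hLim0, hEim'.1, hinvu_im'.1, hQim_nonpos]
  · rw [hDim]
    linarith only [hLim1, hEim'.2, hinvu_im'.2, hQim_bd, Real.pi_lt_d2, hℓ]

end den

end Summit.RiemannHypothesis.RiemannHypothesis.Theorems.JensenPolynomials.LogBandArc

end
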